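import Literature.LinearAlgebra.Matrix.CubicChevalleyDifferential         -- ★ (LH1-p03) (D4a): `exists_mul_sub_eq_zero_iff_not_linearIndependent` (non-regular ⟺ quadratic annihilator)
import Literature.LinearAlgebra.Matrix.UnitaryThreeMinimalNilpotentWitt    -- ★ p852074 (F0P3-p02) (E): `exists_eq_smul_vecMulVec_of_mem` (skew square-zero ⟹ isotropic rank one); brings ★ (C) `nonregular_trichotomy`
import HarnessLib

/-!
# `3 × 3` matrices of TRACE ZERO: a non-zero NON-REGULAR one is either SQUARE-ZERO or SEMISIMPLE NON-SCALAR of type `(a,a,b)` — the switch of the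
# local-integrability road for `|D_G|^{−1∕2}` on `𝔲(Φ₃)₀` (square-zero ↦ Slodowy slice at the minimal nilpotent; `(a,a,b)` ↦ descent to the centraliser)

Topic `LinearAlgebra/Matrix`; namespace `Literature.LinearAlgebra.Matrix`.  THEOREMS ONLY (no definition, no instance, no notation, no named fact, no `sorry`);
imports ★ `CubicChevalleyDifferential` ((D4a) regularity criterion) and ★ `UnitaryThreeMinimalNilpotentWitt` ((E), which brings ★ `CubicCharpolyDiscrNonRegular` (C)).
Written as brick (NG) «NON-REGULAR GLUE on `↥𝔲₀`» of the `hodgecm-mathlib` cell's ROAD «HC-D» (crux H413 = `stmt-HodgeConjecture-24833`; dealer F0P2-p01 (g23),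
2026-09-02T16:46:17Z; seat LH6-p02 (g7)); count-neutral.  It is the case split the GLOBAL assembly uses to send a non-regular point `X ≠ 0` of the trace-zero
Lie algebra `𝔲₀` either to the minimal-nilpotent branch (D5(iii): `X² = 0`, rank one) or to the semisimple branch (D5(ii): type `(a,a,b)`, `a ≠ b`, non-scalar).

THE MATHEMATICS.  Over a field `K` with `3 ≠ 0`, let `X : M₃(K)` have `tr X = 0`, `X ≠ 0`, and let `1, X, X²` be linearly DEPENDENT (non-regular = non-cyclic).
By ★ (D4a) `exists_mul_sub_eq_zero_iff_not_linearIndependent` there are `a b` with `(X − a•1)(X − b•1) = 0`; by ★ (C) `nonregular_trichotomy` either `X = a'•1` is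
scalar — then `0 = tr X = 3a'` forces `X = 0`, excluded —, or `a = b` and `N := X − a•1 ≠ 0` with `N² = 0` — then `N` is nilpotent, so `tr N = 0` (Mathlib
`Matrix.isNilpotent_trace_of_isNilpotent`, a field is reduced), i.e. `3a = tr X − tr N = 0`, `a = 0`, and **`X² = 0`** —, or `a ≠ b` and `X` is **non-scalar with the
split quadratic annihilator `(X − a•1)(X − b•1)`** (semisimple of type `(a,a,b)` ∕ `(a,b,b)`).
* §1 trace bookkeeping: `trace_smul_one_fin_three` (`tr (c•1) = 3c`), `trace_sub_smul_one_fin_three`, `eq_zero_of_smul_one_of_trace_eq_zero`,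
  `trace_eq_zero_of_mul_self_eq_zero` (any square-zero matrix over a field has trace `0`), `eq_zero_of_sub_smul_one_mul_self_eq_zero` (`(X − a•1)² = 0`, `tr X = 0` ⇒ `a = 0`).
* §2 **`mul_self_eq_zero_or_splitSemisimple_of_trace_eq_zero`** — the dealt head, token for token:
  `(X * X = 0) ∨ (∃ a b : K, a ≠ b ∧ (X − a • 1) * (X − b • 1) = 0 ∧ ∀ c : K, X ≠ c • 1)`; and the variant from an explicit annihilator (`…_of_mul_sub_eq_zero`).
* §3 the SKEW add-on in the letters of ★ (E) (`σ` an involution of `E`, `J = antidiag(1,1,1)`, `X ∈ 𝔲 ⟺ (X.map σ)ᵀ J + J X = 0`):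
  **`skew_rankOne_or_splitSemisimple_of_trace_eq_zero`** — a non-zero non-regular `X ∈ 𝔲₀` is either `c • u (σu J)ᵀ`-shaped (`u ≠ 0` isotropic, `σ c = −c ≠ 0`: ★ (E)
  `exists_eq_smul_vecMulVec_of_mem` on the square-zero branch) or split semisimple non-scalar as in §2.

## References
* [HornJohnson2013] R. A. Horn, C. R. Johnson, *Matrix Analysis*, 2nd ed. (2013): §1.2 Problem 1.2.P18 (`p_A(t) = t³ − (tr A)t² + …`; trace and eigenvalues), §0.4.6 (rank-one
  matrices), §3.3 (minimal polynomial; Thm. 3.3.15). Context locator for §1–§2.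
* [Humphreys1972] J. E. Humphreys, *Introduction to Lie Algebras and Representation Theory*, GTM 9 (1972), §23.2 (regular ∕ non-regular elements). Context locator.
-/

set_option autoImplicit false

noncomputable section

open Matrix

namespace Literature.LinearAlgebra.Matrix

/-! ## §1 Trace bookkeeping on `M₃(K)` -/

section Trace

variable {K : Type*} [Field K]

/-- `tr (c • 1) = 3c` on `M₃(K)`. [cite: HornJohnson2013, §1.2 Problem 1.2.P18] -/
theorem trace_smul_one_fin_three (c : K) : Matrix.trace (c • (1 : Matrix (Fin 3) (Fin 3) K)) = 3 * c := by
  rw [Matrix.trace_smul, Matrix.trace_one, Fintype.card_fin, smul_eq_mul]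
  push_cast
  ring

/-- `tr (X − a • 1) = tr X − 3a` on `M₃(K)`. [cite: HornJohnson2013, §1.2 Problem 1.2.P18] -/
theorem trace_sub_smul_one_fin_three (X : Matrix (Fin 3) (Fin 3) K) (a : K) :
    Matrix.trace (X - a • (1 : Matrix (Fin 3) (Fin 3) K)) = Matrix.trace X - 3 * a := by
  rw [Matrix.trace_sub, trace_smul_one_fin_three]

/-- **A scalar matrix of trace zero vanishes** (`3 ≠ 0` in `K`): `X = c • 1`, `tr X = 0` ⇒ `X = 0`. [cite: HornJohnson2013, §1.2 Problem 1.2.P18] -/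
theorem eq_zero_of_smul_one_of_trace_eq_zero (h3 : (3 : K) ≠ 0) {X : Matrix (Fin 3) (Fin 3) K} {c : K} (hX : X = c • 1)
    (htr : Matrix.trace X = 0) : X = 0 := by
  have hc : c = 0 := by
    rw [hX, trace_smul_one_fin_three] at htr
    rcases mul_eq_zero.1 htr with h | h
    · exact absurd h h3
    · exact h
  rw [hX, hc, zero_smul]

/-- **A square-zero matrix over a field has trace zero** (it is nilpotent, so its trace is nilpotent — Mathlib `Matrix.isNilpotent_trace_of_isNilpotent` — and a field is reduced).
[cite: HornJohnson2013, §1.2 Problem 1.2.P18] -/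
theorem trace_eq_zero_of_mul_self_eq_zero {n : Type*} [Fintype n] [DecidableEq n] {N : Matrix n n K} (h : N * N = 0) : Matrix.trace N = 0 :=
  (Matrix.isNilpotent_trace_of_isNilpotent ⟨2, by rw [pow_two, h]⟩).eq_zero

/-- **`(X − a•1)² = 0` with `tr X = 0` forces `a = 0`** (`3 ≠ 0`): `0 = tr (X − a•1) = tr X − 3a`. [cite: HornJohnson2013, §1.2 Problem 1.2.P18] -/
theorem eq_zero_of_sub_smul_one_mul_self_eq_zero (h3 : (3 : K) ≠ 0) {X : Matrix (Fin 3) (Fin 3) K} {a : K}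
    (h : (X - a • (1 : Matrix (Fin 3) (Fin 3) K)) * (X - a • 1) = 0) (htr : Matrix.trace X = 0) : a = 0 := by
  have h0 := trace_eq_zero_of_mul_self_eq_zero h
  rw [trace_sub_smul_one_fin_three, htr, zero_sub, neg_eq_zero] at h0
  rcases mul_eq_zero.1 h0 with h' | h'
  · exact absurd h' h3
  · exact h'

end Trace

/-! ## §2 The dichotomy for non-zero non-regular matrices of trace zero -/

section Dichotomy

variable {K : Type*} [Field K]

/-- **Square-zero or split semisimple, from an explicit quadratic annihilator**: `tr X = 0`, `X ≠ 0`, `(X − a•1)(X − b•1) = 0`, `3 ≠ 0` ⇒ `X² = 0`, or `a ≠ b` and `X` is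
non-scalar (then `X` is semisimple of type `(a,a,b)` ∕ `(a,b,b)`). [cite: HornJohnson2013, §1.2 Problem 1.2.P18; §3.3 Thm. 3.3.15] -/
theorem mul_self_eq_zero_or_splitSemisimple_of_mul_sub_eq_zero (h3 : (3 : K) ≠ 0) {X : Matrix (Fin 3) (Fin 3) K}
    (htr : Matrix.trace X = 0) (h0 : X ≠ 0) {a b : K} (h : (X - a • (1 : Matrix (Fin 3) (Fin 3) K)) * (X - b • 1) = 0) :
    X * X = 0 ∨ (a ≠ b ∧ (X - a • (1 : Matrix (Fin 3) (Fin 3) K)) * (X - b • 1) = 0 ∧ ∀ c : K, X ≠ c • 1) := by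
  rcases nonregular_trichotomy h with ⟨a', ha'⟩ | ⟨hab, -, hsq⟩ | ⟨hab, hns⟩
  · exact absurd (eq_zero_of_smul_one_of_trace_eq_zero h3 ha' htr) h0
  · -- `a = b`, `(X − a•1)² = 0`: the trace forces `a = 0`
    have ha : a = 0 := eq_zero_of_sub_smul_one_mul_self_eq_zero h3 hsq htr
    rw [ha, zero_smul, sub_zero] at hsq
    exact Or.inl hsq
  · exact Or.inr ⟨hab, h, hns⟩

/-- **(NG) «NON-REGULAR GLUE» — square-zero or split semisimple.**  Over a field with `3 ≠ 0`, a NON-ZERO matrix `X ∈ M₃(K)` of TRACE ZERO whose powers `1, X, X²` are linearly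
DEPENDENT (i.e. `X` is not regular ∕ cyclic) is either SQUARE-ZERO (`X² = 0`: rank one, the minimal nilpotent orbit) or NON-SCALAR with a SPLIT quadratic annihilator
`(X − a•1)(X − b•1) = 0`, `a ≠ b` (semisimple of type `(a,a,b)`, `2a + b = 0`).  (★ (D4a) gives the annihilator, ★ (C) the trichotomy, §1 kills the scalar case and pins `a = 0`
in the nilpotent case.) [cite: HornJohnson2013, §1.2 Problem 1.2.P18; §3.3 Thm. 3.3.15] [cite: Humphreys1972, §23.2] -/
theorem mul_self_eq_zero_or_splitSemisimple_of_trace_eq_zero (h3 : (3 : K) ≠ 0) {X : Matrix (Fin 3) (Fin 3) K}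
    (htr : Matrix.trace X = 0) (h0 : X ≠ 0) (hnr : ¬ LinearIndependent K ![(1 : Matrix (Fin 3) (Fin 3) K), X, X ^ 2]) :
    X * X = 0 ∨ (∃ a b : K, a ≠ b ∧ (X - a • (1 : Matrix (Fin 3) (Fin 3) K)) * (X - b • 1) = 0 ∧ ∀ c : K, X ≠ c • 1) := by
  obtain ⟨a, b, h⟩ := (CubicChevalleyDifferential.exists_mul_sub_eq_zero_iff_not_linearIndependent X).2 hnr
  rcases mul_self_eq_zero_or_splitSemisimple_of_mul_sub_eq_zero h3 htr h0 h with hsq | ⟨hab, h', hns⟩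
  · exact Or.inl hsq
  · exact Or.inr ⟨a, b, hab, h', hns⟩

/-- The two branches are EXCLUSIVE: a square-zero `X ≠ 0` admits no split annihilator with `a ≠ b` and `X` non-scalar — indeed `X² = 0` and `(X − a•1)(X − b•1) = 0` give
`(a + b) • X = ab • 1`, so `X` non-scalar forces `a + b = 0 = ab`, i.e. `a = b = 0`. [cite: HornJohnson2013, §3.3 Thm. 3.3.15] -/
theorem not_splitSemisimple_of_mul_self_eq_zero {X : Matrix (Fin 3) (Fin 3) K} (hsq : X * X = 0) {a b : K} (hab : a ≠ b)
    (h : (X - a • (1 : Matrix (Fin 3) (Fin 3) K)) * (X - b • 1) = 0) (hns : ∀ c : K, X ≠ c • 1) : False := by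
  -- expand the annihilator: `X² − (a+b)•X + (ab)•1 = 0`, so with `X² = 0`: `(a + b) • X = (a * b) • 1`
  have key : (a + b) • X = (a * b) • (1 : Matrix (Fin 3) (Fin 3) K) := by
    have h' : X * X - (a + b) • X + (a * b) • (1 : Matrix (Fin 3) (Fin 3) K) = 0 := by
      rw [← h]
      simp only [sub_mul, mul_sub, Matrix.mul_smul, Matrix.smul_mul, Matrix.mul_one, Matrix.one_mul, smul_smul, add_smul, mul_comm b a]
      abel
    rw [hsq, zero_sub] at h'
    rw [neg_add_eq_zero] at h'
    exact h'
  by_cases hs : a + b = 0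
  · -- then `ab = 0`; with `b = −a` this gives `a = 0 = b`, contradicting `a ≠ b`
    rw [hs, zero_smul] at key
    have hab0 : a * b = 0 := by
      have := congrArg (fun M : Matrix (Fin 3) (Fin 3) K => M 0 0) key
      simpa using this
    have hb : b = -a := by linear_combination hs
    rw [hb, mul_neg, neg_eq_zero, mul_self_eq_zero] at hab0
    exact hab (by rw [hb, hab0, neg_zero])
  · -- then `X = ((a+b)⁻¹ ab) • 1` is scalar
    exact hns ((a + b)⁻¹ * (a * b)) (by rw [← smul_smul, ← key, smul_smul, inv_mul_cancel₀ hs, one_smul])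

end Dichotomy

/-! ## §3 The skew-hermitian add-on: in `𝔲₀` the square-zero branch is an isotropic rank-one matrix (★ (E)) -/

section Skew

variable {E : Type*} [Field E] (σ : E →+* E)

/-- **(NG) on `𝔲(Φ₃)₀`** — in the letters of ★ (E) `UnitaryThreeWitt.exists_eq_smul_vecMulVec_of_mem` (`σ` an involution of `E`, `J = antidiag(1,1,1)`, `X` skew-hermitian:
`(X.map σ)ᵀ J + J X = 0`): over `E` with `3 ≠ 0`, a NON-ZERO, TRACE-ZERO, NON-REGULAR skew-hermitian `X` is either the ISOTROPIC RANK-ONE matrix `c • u (σu · J)ᵀ` (`u ≠ 0`,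
`⟨σu J, u⟩ = 0`, `σ c = −c ≠ 0`) — the square-zero branch through ★ (E) — or NON-SCALAR with a split quadratic annihilator `(X − a•1)(X − b•1) = 0`, `a ≠ b`.
[cite: HornJohnson2013, §0.4.6; §1.2 Problem 1.2.P18; §3.3 Thm. 3.3.15] [cite: Humphreys1972, §23.2] -/
theorem skew_rankOne_or_splitSemisimple_of_trace_eq_zero (hσ : ∀ x, σ (σ x) = x) (h3 : (3 : E) ≠ 0) {X : Matrix (Fin 3) (Fin 3) E}
    (hX : (X.map σ)ᵀ * !![(0 : E), 0, 1; 0, 1, 0; 1, 0, 0] + !![(0 : E), 0, 1; 0, 1, 0; 1, 0, 0] * X = 0)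
    (htr : Matrix.trace X = 0) (h0 : X ≠ 0) (hnr : ¬ LinearIndependent E ![(1 : Matrix (Fin 3) (Fin 3) E), X, X ^ 2]) :
    (∃ (u : Fin 3 → E) (c : E), u ≠ 0 ∧ c ≠ 0 ∧ σ c = -c ∧ vecMul (σ ∘ u) !![(0 : E), 0, 1; 0, 1, 0; 1, 0, 0] ⬝ᵥ u = 0 ∧
        X = c • vecMulVec u (vecMul (σ ∘ u) !![(0 : E), 0, 1; 0, 1, 0; 1, 0, 0])) ∨
      (∃ a b : E, a ≠ b ∧ (X - a • (1 : Matrix (Fin 3) (Fin 3) E)) * (X - b • 1) = 0 ∧ ∀ c : E, X ≠ c • 1) := by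
  rcases mul_self_eq_zero_or_splitSemisimple_of_trace_eq_zero h3 htr h0 hnr with hsq | hss
  · exact Or.inl (UnitaryThreeWitt.exists_eq_smul_vecMulVec_of_mem σ hσ hX h0 hsq)
  · exact Or.inr hss

/-- The square-zero branch alone, in the same letters: a non-zero trace-zero non-regular skew-hermitian `X` WITHOUT a split non-scalar annihilator is isotropic rank one.
[cite: HornJohnson2013, §0.4.6; §3.3 Thm. 3.3.15] -/
theorem skew_rankOne_of_trace_eq_zero_of_forall (hσ : ∀ x, σ (σ x) = x) (h3 : (3 : E) ≠ 0) {X : Matrix (Fin 3) (Fin 3) E}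
    (hX : (X.map σ)ᵀ * !![(0 : E), 0, 1; 0, 1, 0; 1, 0, 0] + !![(0 : E), 0, 1; 0, 1, 0; 1, 0, 0] * X = 0)
    (htr : Matrix.trace X = 0) (h0 : X ≠ 0) (hnr : ¬ LinearIndependent E ![(1 : Matrix (Fin 3) (Fin 3) E), X, X ^ 2])
    (hno : ∀ a b : E, a ≠ b → (X - a • (1 : Matrix (Fin 3) (Fin 3) E)) * (X - b • 1) = 0 → ∃ c : E, X = c • 1) :
    ∃ (u : Fin 3 → E) (c : E), u ≠ 0 ∧ c ≠ 0 ∧ σ c = -c ∧ vecMul (σ ∘ u) !![(0 : E), 0, 1; 0, 1, 0; 1, 0, 0] ⬝ᵥ u = 0 ∧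
      X = c • vecMulVec u (vecMul (σ ∘ u) !![(0 : E), 0, 1; 0, 1, 0; 1, 0, 0]) := by
  rcases skew_rankOne_or_splitSemisimple_of_trace_eq_zero σ hσ h3 hX htr h0 hnr with h | ⟨a, b, hab, h, hns⟩
  · exact h
  · obtain ⟨c, hc⟩ := hno a b hab h
    exact absurd hc (hns c)

end Skew

end Literature.LinearAlgebra.Matrix

end
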